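import Literature.AlgebraicGeometry.Shioda1982.ExceptionalQuadruplesComplete
import HarnessLib

/-!
# Shioda 1982 / Meyer–Neutsch 1981: no exceptional quadruple at the level `N = 200` (kernel sweep above Aoki's bound `180`)

Topic `Literature/AlgebraicGeometry/Shioda1982`; companion of `ExceptionalQuadruplesComplete.lean` (search `checkB`, soundness
`tabelleOneCompleteAt_of_chunks`, invariant form `exists_mem_reps_of_isExceptionalQuadruple`, statement `TabelleOneCompleteAt`; sources,
method and framing in its module docstring) and of the series `ExceptionalQuadruplesSweep*.lean` (together: every level `2 ≤ N ≤ 180`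
that is not a row of Tabelle 1; `…SweepTwoHundredTwenty/…TwoHundredSixty/…ThreeHundredForty.lean` and
`…SweepTwoHundredFiftyTwo/…ThreeHundredNinetySix/…FourHundredSixtyEight.lean`: the levels `220, 260, 340` and `252, 396, 468` of the
families `20p`, `36p`). THEOREMS only (no definition, no named fact): the same kernel search at the single level `N = 200`,
which carries NO row of [MeyerNeutsch1981Fermatquadrupel, Tabelle 1] (computer-generated there, "alle Fermatquadrupel für N ≤ 614
ermittelt", §2 p. 53) and lies above the range `N ≤ 180` of Shioda's table p. 727 — by Aoki's Theorem C ([Aoki1983], computer-assisted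
for `181 ≤ m ≤ 672`) there is no exceptional element at any level `> 180`; this file makes the instance `N = 200` a kernel statement:
`completeAt_twoHundred` (every sorted pair-free primitive Hodge 4-multiset mod `200` is standard) and `not_isExceptionalQuadruple_twoHundred`.
WHY THIS LEVEL (cell `pub-hfermat`): `200 = 40·5`, the instance `p = 5` of the family `m = 40p` of
`HodgeQuadruplesFortyPrime.lean` (`classify_hodgeMultiset_fortyPrime`, `p ≥ 19`) below its range — a residual prime of the
companion `PicardNumberFortyPrime.lean` (`exceptional_fortyPrime`). `decide +kernel` only (no `native_decide`), chunked by first entries to bound the memory of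
a single kernel evaluation (14 chunks; this file visits 227239 candidate triples, `φ(200) − 1 = 79` units each).

HONEST FRAMING (cell `pub-hfermat`): explicit algebraic cycles for specific Hodge classes on Fermat/Delsarte varieties; residual open
instances listed; no claim on general Hodge. These classes are algebraic (Lefschetz (1,1)); certified here is only the emptiness of the
exceptional list at this level.

## References
* [MeyerNeutsch1981Fermatquadrupel] W. Meyer, W. Neutsch, *Fermatquadrupel*, Math. Ann. 256 (1981) 51–62, §2 p. 53, Tabelle 1 p. 54 (no row 200).
* [Shioda1982PicardFermat] T. Shioda, J. Fac. Sci. Univ. Tokyo IA 28 (1982) 725–734, table p. 727 (levels `≤ 180`), Prop. 4 (Q′) p. 729.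
* [Aoki1983] N. Aoki, Math. Ann. 266 (1983) 23–54, Thm. C.
-/

namespace Literature.AlgebraicGeometry.Shioda1982

open Literature.AlgebraicGeometry.HodgeTheory

set_option maxHeartbeats 0 in
/-- **Tabelle 1 is complete at `N = 200`, where it is empty**: every sorted Hodge 4-multiset mod `200` without a pair and with
`gcd = 1` is standard. Kernel exhaustion (`checkB`, 14 chunks of first entries, 227239 candidate triples).
[cite: MeyerNeutsch1981Fermatquadrupel, §2 p. 53 ("alle Fermatquadrupel für N ≤ 614 ermittelt") and Tabelle 1 p. 54 (no row 200)]
[cite: Aoki1983, Thm. C] [cite: Shioda1982PicardFermat, Prop. 4 (Q′) p. 729] -/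
theorem completeAt_twoHundred : TabelleOneCompleteAt 200 :=
  tabelleOneCompleteAt_of_chunks 200 [(0, 5), (5, 5), (10, 4), (14, 4), (18, 4), (22, 4), (26, 5), (31, 5), (36, 5), (41, 5), (46, 6), (52, 7), (59, 9), (68, 132)] (by decide +kernel) (by
    intro p hp
    simp only [List.mem_cons, List.not_mem_nil, or_false] at hp
    rcases hp with rfl | rfl | rfl | rfl | rfl | rfl | rfl | rfl | rfl | rfl | rfl | rfl | rfl | rfl <;> decide +kernel)

/-- **No exceptional quadruple ("Ausnahmequadrupel") at the level `200`** (`tabelleOne 200 = []`).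
[cite: MeyerNeutsch1981Fermatquadrupel, Tabelle 1 p. 54 (no row 200)] [cite: Aoki1983, Thm. C] -/
theorem not_isExceptionalQuadruple_twoHundred (s : Multiset (ZMod 200)) : ¬ IsExceptionalQuadruple 200 s := by
  intro hs
  obtain ⟨r, hr, -⟩ := exists_mem_reps_of_isExceptionalQuadruple completeAt_twoHundred hs
  simp [reps, tabelleOne] at hr

end Literature.AlgebraicGeometry.Shioda1982
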